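import Literature.AlgebraicGeometry.Resolution.FiniteExtensionUniformization
import Literature.AlgebraicGeometry.Resolution.ValuedFunctionFieldsLemmas
import Literature.AlgebraicGeometry.Resolution.ValuationIndependence
import Mathlib.RingTheory.Smooth.NoetherianDescent
import Mathlib.RingTheory.Smooth.Flat
import Mathlib.RingTheory.Flat.Basic
import Mathlib.LinearAlgebra.TensorProduct.Finiteness
import HarnessLib

/-!
# Proofs of ingredients of Knaf–Kuhlmann 2009, Thm. 1.2: KK09 Prop. 3.2, Prop. 3.4 (2), KK05 Cor. 2.2

Topic: `Literature/AlgebraicGeometry/Resolution`. We DISCHARGE three of the named facts of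
`FiniteExtensionUniformization.lean`: `KnafKuhlmann2009_Prop32` (Knaf–Kuhlmann 2009, Prop. 3.2:
descent of a finitely presented algebra smooth at the centre of a valuation from a ring `S` to
the subrings `S' ⊆ S` containing a suitable finitely generated `S₀`), `KnafKuhlmann2009_Prop34_2`
(Prop. 3.4 (2): finite descent of smooth uniformizability along a constant extension) and
`KnafKuhlmann2005_Cor22` (Knaf–Kuhlmann 2005, Cor. 2.2: for an Abhyankar place of a function
field, `vF/vK` and `FP|KP` are finitely generated).

## Proof of Prop. 3.2

The printed proof (p. 14 of arXiv:math/0702856v1) shrinks `A` to a standard-smooth `A_u`, reads off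
the finitely many coefficients of a standard presentation, and uses normality of `S'` (Gauß'
lemma) to see that the same presentation over `S'` still defines a subring of `A_q`. We replace
the last step by flatness: by Mathlib's Noetherian descent of smooth algebras
(`Algebra.Smooth.exists_subalgebra_fg`, [Stacks 00TP]) `A_u ≅ S ⊗[A₀] B₀` for a finitely generated
`ℤ`-subalgebra `A₀ ⊆ S` and a smooth `A₀`-algebra `B₀`; for `A₀ ⊆ S' ⊆ S` the algebra
`S' ⊗[A₀] B₀` is smooth and finitely presented over `S'` (base change) and maps injectively to
`S ⊗[A₀] B₀ = A_u ⊆ Ω` because `B₀` is flat over `A₀`; its image `A' = S'[G]`, `G` the image of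
a finite generating set of `B₀`, is the required model. In particular the normality hypotheses
of the printed statement are not used, and the model over `S'` is generated by a finite set
independent of `S'` (`knafKuhlmann2009_prop32_adjoin`).

## Proof of Prop. 3.4 (2)

Given an `O_L`-model of `F.L` smooth at the centre, the strong form of Prop. 3.2 gives `S₀ ⊆ O_L`
and `G`; with `Λ ⊆ L` finite such that `G ⊆ F.K(Λ)` (a compositum is the directed union of the
composita with finitely generated subextensions), `M := K(S₀, Λ)` and `S' := V ∩ M`, the algebra
`S'[G]` is an `O_M`-model of `F.M` smooth at the centre containing `Z` in its local ring. (The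
printed proof instead re-ascends from `M'` to `N ⊇ M'` by Prop. 3.4 (1); with the explicit
generators `G` this is unnecessary, and "`L|K` algebraic" is not used.)

## Proof of KK05 Cor. 2.2

As printed: with `x, y` as in `IsAbhyankarPlace` and `F₀ := K(x, y)`, the extension `F|F₀` is
finite; `vF₀ = vK · ∏ v(xᵢ)^ℤ` and `F₀P = KP(yP)` by Knaf–Kuhlmann 2005, Thm. 2.1
(`ValuationIndependence.lean`); by the finiteness half of the fundamental inequality (ibid.) a
family of elements of `F` with values in distinct cosets modulo `vF₀`, resp. with residues
linearly independent over `F₀P`, has at most `[F : F₀]` members, so a maximal such family is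
finite and yields the generators.

## Sources

* H. Knaf, F.-V. Kuhlmann, *Every place admits local uniformization in a finite extension of
  the function field*, Adv. Math. 221 (2009) 428–453 = arXiv:math/0702856, Prop. 3.2 and
  Prop. 3.4 (pp. 14–16 in the printed pagination of arXiv v1).
* H. Knaf, F.-V. Kuhlmann, *Abhyankar places admit local uniformization in any characteristic*,
  Ann. Sci. ÉNS 38 (2005) 833–846 = arXiv:math/0304159, Cor. 2.2 and its proof (p. 6 of the
  arXiv PDF).
-/

noncomputable section

namespace Literature.AlgebraicGeometry.Resolution

universe u

open IsLocalRing TensorProduct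

variable {Ω : Type u} [Field Ω]

/-! ## Rings mapping into `Ω` with nested images -/

section RangeSubset

variable {S' S : Type*} [CommRing S'] [CommRing S] [Algebra S' Ω] [Algebra S Ω]

/-- If `range S' ⊆ range S` inside `Ω`, every `x ∈ S'` has a preimage in `S`. [folklore] -/
theorem exists_algebraMap_eq_of_rangeSubset
    (h : Set.range (algebraMap S' Ω) ⊆ Set.range (algebraMap S Ω)) (x : S') :
    ∃ s : S, algebraMap S Ω s = algebraMap S' Ω x := by
  obtain ⟨s, hs⟩ := h ⟨x, rfl⟩
  exact ⟨s, hs⟩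

/-- The chosen preimages of `exists_algebraMap_eq_of_rangeSubset`. [folklore] -/
theorem algebraMap_choose_rangeSubset
    (h : Set.range (algebraMap S' Ω) ⊆ Set.range (algebraMap S Ω)) (x : S') :
    algebraMap S Ω (exists_algebraMap_eq_of_rangeSubset h x).choose = algebraMap S' Ω x :=
  (exists_algebraMap_eq_of_rangeSubset h x).choose_spec

end RangeSubset

/-! ## Prop. 3.2 -/

/-- **Knaf–Kuhlmann 2009, Prop. 3.2, strong form, PROVED**: for a ring `S` mapping injectively
into the valued field `(Ω, V)`, a finitely presented `S`-subalgebra `A ⊆ V` of `Ω` smooth over `S`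
at the centre of `V` and a finite `Z ⊆ A_q`, there are finite sets `S₀ ⊆ S` and `G ⊆ A_q` such
that for EVERY ring `S'` mapping injectively into `Ω` with `S₀ ⊆ S' ⊆ S` the `S'`-subalgebra
`A' := S'[G] ⊆ A_q` is finitely presented and smooth over `S'` at the centre of `V`, `Z ⊆ A'_{q'}`
and `Frac A = Frac(A').Frac(S)`. Compared with the printed Prop. 3.2: no normality (or domain)
hypotheses, and the model over `S'` is generated by a finite set `G` independent of `S'`. Proof:
Noetherian descent of smooth algebras and flatness (module docstring).
[cite: KnafKuhlmann2009, Prop. 3.2] -/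
theorem knafKuhlmann2009_prop32_adjoin (V : ValuationSubring Ω) (S : Type u) [CommRing S]
    [Algebra S Ω] (hSinj : Function.Injective (algebraMap S Ω)) (A : Subalgebra S Ω)
    (hAV : A.toSubring ≤ V.toSubring) [Algebra.FinitePresentation S A]
    (hsm : Algebra.IsSmoothAt S (centre A V hAV)) (Z : Finset Ω)
    (hZ : ∀ z ∈ Z, ∃ a ∈ A, ∃ b ∈ A, V.valuation b = 1 ∧ z = a / b) :
    ∃ S₀ G : Finset Ω, (S₀ : Set Ω) ⊆ Set.range (algebraMap S Ω) ∧
      (∀ g ∈ G, ∃ a ∈ A, ∃ b ∈ A, V.valuation b = 1 ∧ g = a / b) ∧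
      ∀ (S' : Type u) [CommRing S'] [Algebra S' Ω], Function.Injective (algebraMap S' Ω) →
        (S₀ : Set Ω) ⊆ Set.range (algebraMap S' Ω) →
        Set.range (algebraMap S' Ω) ⊆ Set.range (algebraMap S Ω) →
        ∃ (A' : Subalgebra S' Ω) (hA'V : A'.toSubring ≤ V.toSubring),
          A' = Algebra.adjoin S' (G : Set Ω) ∧
          (∀ x ∈ A', ∃ a ∈ A, ∃ b ∈ A, V.valuation b = 1 ∧ x = a / b) ∧
          Algebra.FinitePresentation S' A' ∧ Algebra.IsSmoothAt S' (centre A' V hA'V) ∧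
          (∀ z ∈ Z, ∃ a ∈ A', ∃ b ∈ A', V.valuation b = 1 ∧ z = a / b) ∧
          Subfield.closure ((A' : Set Ω) ∪ Set.range (algebraMap S Ω)) =
            Subfield.closure (A : Set Ω) := by
  classical
  haveI : Algebra.IsSmoothAt S (centre A V hAV) := hsm
  -- Step 1: `B₁ := A[1/f]`, smooth over `S`
  obtain ⟨f, hfq, hfsm⟩ := Algebra.IsSmoothAt.exists_notMem_smooth S (centre A V hAV)
  have hvf : V.valuation (f : Ω) = 1 := by
    have h1 : V.valuation (f : Ω) ≤ 1 := (V.valuation_le_one_iff _).mpr (hAV f.2)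
    have h2 : ¬ V.valuation (f : Ω) < 1 := fun hlt => hfq ((mem_centre_iff A V hAV f).mpr hlt)
    exact le_antisymm h1 (not_lt.mp h2)
  have hf0 : (f : Ω) ≠ 0 := fun h0 => by simp [h0] at hvf
  let B₁ : Subalgebra S Ω := locAway A (f : Ω) f.2
  haveI hsm₁ : Algebra.Smooth S B₁ := smooth_locAway hf0 (by simpa using hfsm)
  have hB₁V : B₁.toSubring ≤ V.toSubring := locAway_le_valuationSubring hAV hvf
  have hB₁A : ∀ x ∈ B₁, ∃ a ∈ A, ∃ b ∈ A, V.valuation b = 1 ∧ x = a / b := by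
    intro x hx
    obtain ⟨a, ha, n, rfl⟩ := (mem_locAway_iff_exists_div hf0).mp hx
    exact ⟨a, ha, (f : Ω) ^ n, pow_mem f.2 n, by rw [map_pow, hvf, one_pow], rfl⟩
  have hAB₁ : A ≤ B₁ := le_locAway
  -- Step 2: Noetherian descent `B₁ ≃ S ⊗[A₀] B₀`
  obtain ⟨A₀, B₀, _, _, hA₀fg, hB₀sm, ⟨e⟩⟩ := Algebra.Smooth.exists_subalgebra_fg ℤ S B₁
  haveI := hB₀sm
  -- the images `β b := e⁻¹ (1 ⊗ b)` of `B₀` in `Ω`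
  let β : B₀ → Ω := fun b => ((e.symm ((1 : S) ⊗ₜ[A₀] b) : B₁) : Ω)
  have htmul : ∀ (s : S) (b : B₀),
      ((e.symm (s ⊗ₜ[A₀] b) : B₁) : Ω) = algebraMap S Ω s * β b := by
    intro s b
    have h1 : (s ⊗ₜ[A₀] b : S ⊗[A₀] B₀) = s • ((1 : S) ⊗ₜ[A₀] b) := by
      rw [TensorProduct.smul_tmul', smul_eq_mul, mul_one]
    rw [h1, map_smul, Subalgebra.coe_smul, Algebra.smul_def]
  -- every element of `B₁` is `∑ sᵢ β(bᵢ)`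
  have hrep : ∀ x : B₁, ∃ T : Finset (S × B₀),
      (x : Ω) = ∑ p ∈ T, algebraMap S Ω p.1 * β p.2 := by
    intro x
    obtain ⟨T, hT⟩ := TensorProduct.exists_finset (e x)
    refine ⟨T, ?_⟩
    have hx : x = e.symm (e x) := (e.symm_apply_apply x).symm
    conv_lhs => rw [hx, hT, map_sum]
    rw [AddSubmonoidClass.coe_finsetSum]
    exact Finset.sum_congr rfl fun p _ => htmul p.1 p.2
  -- Step 3: the finite sets `S₀` and `G`
  obtain ⟨tB, htB⟩ : (⊤ : Subalgebra A₀ B₀).FG := Algebra.FiniteType.out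
  let G : Finset Ω := tB.image β
  obtain ⟨t₀, ht₀⟩ := hA₀fg
  choose a ha b hb hvb hab using hZ
  choose Ta hTa using fun z (hz : z ∈ Z) => hrep ⟨a z hz, hAB₁ (ha z hz)⟩
  choose Tb hTb using fun z (hz : z ∈ Z) => hrep ⟨b z hz, hAB₁ (hb z hz)⟩
  let φ : S → Ω := algebraMap S Ω
  let S₀ : Finset Ω := t₀.image φ ∪ Z.attach.biUnion fun z =>
    (Ta z.1 z.2).image (fun p => φ p.1) ∪ (Tb z.1 z.2).image (fun p => φ p.1)
  have hS₀t₀ : ∀ s ∈ t₀, φ s ∈ S₀ := fun s hs =>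
    Finset.mem_union_left _ (Finset.mem_image_of_mem _ hs)
  have hS₀a : ∀ z (hz : z ∈ Z), ∀ p ∈ Ta z hz, φ p.1 ∈ S₀ := fun z hz p hp =>
    Finset.mem_union_right _ (Finset.mem_biUnion.mpr ⟨⟨z, hz⟩, Finset.mem_attach _ _,
      Finset.mem_union_left _ (Finset.mem_image.mpr ⟨p, hp, rfl⟩)⟩)
  have hS₀b : ∀ z (hz : z ∈ Z), ∀ p ∈ Tb z hz, φ p.1 ∈ S₀ := fun z hz p hp =>
    Finset.mem_union_right _ (Finset.mem_biUnion.mpr ⟨⟨z, hz⟩, Finset.mem_attach _ _,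
      Finset.mem_union_right _ (Finset.mem_image.mpr ⟨p, hp, rfl⟩)⟩)
  have hβA : ∀ b' : B₀, ∃ a ∈ A, ∃ b ∈ A, V.valuation b = 1 ∧ β b' = a / b := fun b' =>
    hB₁A _ (e.symm _).2
  refine ⟨S₀, G, ?_, ?_, ?_⟩
  · -- `S₀ ⊆ range S`
    intro w hw
    simp only [S₀, Finset.coe_union, Finset.coe_image, Finset.coe_biUnion, Set.mem_union,
      Set.mem_image, Set.mem_iUnion, Finset.mem_coe] at hw
    rcases hw with ⟨s, -, rfl⟩ | ⟨z, -, ⟨p, -, rfl⟩ | ⟨p, -, rfl⟩⟩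
    · exact ⟨s, rfl⟩
    · exact ⟨p.1, rfl⟩
    · exact ⟨p.1, rfl⟩
  · -- `G ⊆ A_q`
    intro g hg
    obtain ⟨b', -, rfl⟩ := Finset.mem_image.mp hg
    exact hβA b'
  -- Step 4: the model over `S'`
  intro S' _ _ hS'inj hS₀S' hS'S
  -- the ring homomorphism `ι : S' → S` induced by `range S' ⊆ range S`
  let ι : S' →+* S :=
    { toFun := fun x => (exists_algebraMap_eq_of_rangeSubset hS'S x).choose
      map_one' := hSinj (by rw [algebraMap_choose_rangeSubset hS'S 1, map_one, map_one])
      map_mul' := fun x y => hSinj (by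
        rw [map_mul (algebraMap S Ω), algebraMap_choose_rangeSubset hS'S x,
          algebraMap_choose_rangeSubset hS'S y, algebraMap_choose_rangeSubset hS'S (x * y),
          map_mul])
      map_zero' := hSinj (by rw [algebraMap_choose_rangeSubset hS'S 0, map_zero, map_zero])
      map_add' := fun x y => hSinj (by
        rw [map_add (algebraMap S Ω), algebraMap_choose_rangeSubset hS'S x,
          algebraMap_choose_rangeSubset hS'S y, algebraMap_choose_rangeSubset hS'S (x + y),
          map_add]) }
  have hι : ∀ x, algebraMap S Ω (ι x) = algebraMap S' Ω x := fun x =>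
    algebraMap_choose_rangeSubset hS'S x
  have hιinj : Function.Injective ι := fun x y hxy => hS'inj (by rw [← hι x, ← hι y, hxy])
  -- elements of `S` whose image lies in `range S'` come from `S'`
  have hlift : ∀ s : S, φ s ∈ Set.range (algebraMap S' Ω) → ∃ x : S', ι x = s := by
    rintro s ⟨x, hx⟩
    exact ⟨x, hSinj (by rw [hι]; exact hx)⟩
  -- `A₀ ⊆ ι(S')`
  have hA₀ι : ∀ s : S, s ∈ A₀ → ∃ x : S', ι x = s := by
    intro s hs
    have hsub : A₀ ≤ subalgebraOfSubring ι.range := by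
      rw [← ht₀]
      refine Algebra.adjoin_le fun s' hs' => ?_
      obtain ⟨x, hx⟩ := hlift s' (hS₀S' (hS₀t₀ s' hs'))
      exact ⟨x, hx⟩
    obtain ⟨x, hx⟩ := (mem_subalgebraOfSubring.mp (hsub hs) : s ∈ ι.range)
    exact ⟨x, hx⟩
  choose κf hκf using hA₀ι
  let κ : A₀ →+* S' :=
    { toFun := fun s => κf s.1 s.2
      map_one' := hιinj (by rw [hκf, map_one]; rfl)
      map_mul' := fun x y => hιinj (by rw [hκf, map_mul, hκf, hκf]; rfl)
      map_zero' := hιinj (by rw [hκf, map_zero]; rfl)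
      map_add' := fun x y => hιinj (by rw [hκf, map_add, hκf, hκf]; rfl) }
  have hικ : ∀ s : A₀, ι (κ s) = (s : S) := fun s => hκf s.1 s.2
  -- algebra structures: `A₀ → S' → S → B₁`, `A₀ → S' → Ω`
  letI : Algebra A₀ S' := κ.toAlgebra
  letI : Algebra S' S := ι.toAlgebra
  haveI : IsScalarTower A₀ S' S := IsScalarTower.of_algebraMap_eq fun s => (hικ s).symm
  haveI : IsScalarTower S' S Ω := IsScalarTower.of_algebraMap_eq fun x => (hι x).symm
  haveI : IsScalarTower A₀ S' Ω := IsScalarTower.of_algebraMap_eq fun s => by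
    rw [IsScalarTower.algebraMap_apply A₀ S Ω s]
    change algebraMap S Ω (s : S) = algebraMap S' Ω (κ s)
    rw [← hι, hικ]
  -- the `A₀`-algebra map `g : B₀ → Ω`, `b ↦ β b`
  let g : B₀ →ₐ[A₀] Ω :=
    ((B₁.val).restrictScalars A₀).comp
      (((e.symm : S ⊗[A₀] B₀ ≃ₐ[S] B₁).toAlgHom.restrictScalars A₀).comp
        (Algebra.TensorProduct.includeRight : B₀ →ₐ[A₀] S ⊗[A₀] B₀))
  have hg : ∀ b', g b' = β b' := fun b' => rfl
  -- the `S'`-algebra map `ψ : S' ⊗[A₀] B₀ → Ω`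
  let ψ : S' ⊗[A₀] B₀ →ₐ[S'] Ω :=
    Algebra.TensorProduct.lift (Algebra.ofId S' Ω) g fun _ _ => Commute.all _ _
  have hψ : ∀ (x : S') (b' : B₀), ψ (x ⊗ₜ[A₀] b') = algebraMap S' Ω x * β b' := by
    intro x b'
    change Algebra.TensorProduct.lift (Algebra.ofId S' Ω) g _ (x ⊗ₜ[A₀] b') = _
    rw [Algebra.TensorProduct.lift_tmul]
    rfl
  -- `ψ` factors through `e⁻¹ ∘ (ι ⊗ id)`, hence is injective by flatness of `B₀`
  let ιₐ : S' →ₐ[A₀] S :=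
    { ι with commutes' := fun s => hικ s }
  have hfac : ∀ t : S' ⊗[A₀] B₀,
      ψ t = ((e.symm (ιₐ.toLinearMap.rTensor B₀ t) : B₁) : Ω) := by
    intro t
    induction t using TensorProduct.induction_on with
    | zero => simp
    | tmul x b' =>
      rw [hψ, LinearMap.rTensor_tmul, AlgHom.toLinearMap_apply, htmul, ← hι]
      rfl
    | add t₁ t₂ h₁ h₂ => rw [map_add, h₁, h₂, map_add, map_add, Subalgebra.coe_add]
  haveI : Module.Flat A₀ B₀ := inferInstance
  have hψinj : Function.Injective ψ := by
    intro t₁ t₂ h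
    rw [hfac, hfac] at h
    have h' := e.symm.injective (Subtype.ext h)
    exact Module.Flat.rTensor_preserves_injective_linearMap (M := B₀) ιₐ.toLinearMap hιinj h'
  -- the model `A' := ψ(S' ⊗ B₀) ⊆ B₁`
  let A' : Subalgebra S' Ω := ψ.range
  have hA'B₁ : ∀ x ∈ A', x ∈ B₁ := by
    intro x hx
    obtain ⟨t, rfl⟩ := (AlgHom.mem_range ψ).mp hx
    rw [hfac]
    exact (e.symm _).2
  have hA'V : A'.toSubring ≤ V.toSubring := fun x hx => hB₁V (hA'B₁ x hx)
  -- elements `∑ φ(sᵢ) β(bᵢ)` with all `φ(sᵢ) ∈ range S'` lie in `A'`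
  have hsumA' : ∀ T : Finset (S × B₀), (∀ p ∈ T, φ p.1 ∈ Set.range (algebraMap S' Ω)) →
      ∑ p ∈ T, algebraMap S Ω p.1 * β p.2 ∈ A' := by
    intro T hT
    refine Subalgebra.sum_mem _ fun p hp => ?_
    obtain ⟨x, hx⟩ := hlift p.1 (hT p hp)
    refine (AlgHom.mem_range ψ).mpr ⟨x ⊗ₜ[A₀] p.2, ?_⟩
    rw [hψ, ← hι, hx]
  have hβA' : ∀ b' : B₀, β b' ∈ A' := fun b' =>
    (AlgHom.mem_range ψ).mpr ⟨(1 : S') ⊗ₜ[A₀] b', by rw [hψ, map_one, one_mul]⟩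
  -- `ψ(S' ⊗ B₀) = S'[G]`
  have hGmem : ∀ b' : B₀, β b' ∈ Algebra.adjoin S' (G : Set Ω) := by
    intro b'
    have hb' : b' ∈ Algebra.adjoin A₀ (tB : Set B₀) := by rw [htB]; exact Algebra.mem_top
    refine Algebra.adjoin_induction (fun b'' hb'' => ?_) (fun r => ?_) (fun u v _ _ hu hv => ?_)
      (fun u v _ _ hu hv => ?_) hb'
    · exact Algebra.subset_adjoin (Finset.mem_coe.mpr (Finset.mem_image_of_mem β hb''))
    · rw [← hg, AlgHom.commutes, IsScalarTower.algebraMap_apply A₀ S' Ω]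
      exact Subalgebra.algebraMap_mem _ _
    · rw [← hg, map_add, hg, hg]
      exact add_mem hu hv
    · rw [← hg, map_mul, hg, hg]
      exact mul_mem hu hv
  have hrange : ∀ t : S' ⊗[A₀] B₀, ψ t ∈ Algebra.adjoin S' (G : Set Ω) := by
    intro t
    induction t using TensorProduct.induction_on with
    | zero => rw [map_zero]; exact zero_mem _
    | tmul x b' => rw [hψ]; exact mul_mem (Subalgebra.algebraMap_mem _ x) (hGmem b')
    | add t₁ t₂ h₁ h₂ => rw [map_add]; exact add_mem h₁ h₂
  -- smoothness and finite presentation of `A' ≅ S' ⊗[A₀] B₀`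
  let eA : (S' ⊗[A₀] B₀) ≃ₐ[S'] A' := AlgEquiv.ofInjective ψ hψinj
  haveI : Algebra.Smooth S' (S' ⊗[A₀] B₀) := inferInstance
  haveI hsmA' : Algebra.Smooth S' A' := Algebra.Smooth.of_equiv eA
  have hfpA' : Algebra.FinitePresentation S' A' := inferInstance
  haveI : Algebra.FormallySmooth S' A' := inferInstance
  refine ⟨A', hA'V, ?_, fun x hx => hB₁A x (hA'B₁ x hx), hfpA',
    isSmoothAt_of_formallySmooth (centre A' V hA'V), ?_, ?_⟩
  · -- `A' = S'[G]`
    exact le_antisymm (fun x hx => by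
      obtain ⟨t, rfl⟩ := (AlgHom.mem_range ψ).mp hx
      exact hrange t) (Algebra.adjoin_le fun g' hg' => by
      obtain ⟨b', -, rfl⟩ := Finset.mem_image.mp (Finset.mem_coe.mp hg')
      exact hβA' b')
  · -- `Z ⊆ A'_{q'}`
    intro z hz
    refine ⟨a z hz, ?_, b z hz, ?_, hvb z hz, hab z hz⟩
    · have := hsumA' (Ta z hz) fun p hp => hS₀S' (hS₀a z hz p hp)
      rwa [← hTa z hz] at this
    · have := hsumA' (Tb z hz) fun p hp => hS₀S' (hS₀b z hz p hp)
      rwa [← hTb z hz] at this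
  · -- `Frac A = Frac(A').Frac(S)`
    apply le_antisymm
    · refine Subfield.closure_le.mpr (Set.union_subset (fun x hx => ?_) ?_)
      · obtain ⟨a', ha', b', hb', -, rfl⟩ := hB₁A x (hA'B₁ x hx)
        exact div_mem (Subfield.subset_closure ha') (Subfield.subset_closure hb')
      · rintro _ ⟨s, rfl⟩
        exact Subfield.subset_closure (A.algebraMap_mem s)
    · refine Subfield.closure_le.mpr fun x hx => ?_
      obtain ⟨T, hT⟩ := hrep ⟨x, hAB₁ hx⟩
      change x = _ at hT
      rw [hT]
      refine Subfield.sum_mem _ fun p _ => Subfield.mul_mem _ ?_ ?_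
      · exact Subfield.subset_closure (Or.inr ⟨p.1, rfl⟩)
      · exact Subfield.subset_closure (Or.inl (hβA' p.2))

/-- **Knaf–Kuhlmann 2009, Prop. 3.2, PROVED**: the named fact `KnafKuhlmann2009_Prop32` of
`FiniteExtensionUniformization.lean` (from the strong form `knafKuhlmann2009_prop32_adjoin`; the
normality hypotheses of the printed statement are not needed). [cite: KnafKuhlmann2009,
Prop. 3.2] -/
theorem KnafKuhlmann2009_Prop32_holds : KnafKuhlmann2009_Prop32.{u} := by
  intro Ω _ V S _ _ _ _ hSinj A hAV hfp hsm R _ Z hZ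
  haveI := hfp
  obtain ⟨S₀, G, hS₀, -, h⟩ := knafKuhlmann2009_prop32_adjoin V S hSinj A hAV hsm Z hZ
  refine ⟨S₀, hS₀, fun S' _ _ _ _ hS'inj _ hS₀S' hS'S => ?_⟩
  obtain ⟨A', hA'V, -, hA'A, hfp', hsm', hZ', hcl⟩ := h S' hS'inj hS₀S' hS'S
  exact ⟨A', hA'V, hA'A, hfp', hsm', hZ', hcl⟩

/-! ## Prop. 3.4 (2) -/

/-- A compositum `F.L` inside `Ω` is the directed union of the `F.K(Λ)`, `Λ ⊆ L` finite: every
element of `F ⊔ L` lies in `F ⊔ closure (Λ ∩ L)` for some finite `Λ`. [folklore] -/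
theorem exists_finset_mem_sup_closure (F L : Subfield Ω) {x : Ω} (hx : x ∈ F ⊔ L) :
    ∃ Λ : Finset Ω, x ∈ F ⊔ Subfield.closure ((Λ : Set Ω) ∩ (L : Set Ω)) := by
  classical
  let T : Finset Ω → Subfield Ω := fun Λ => F ⊔ Subfield.closure ((Λ : Set Ω) ∩ (L : Set Ω))
  have hdir : Directed (· ≤ ·) T := by
    refine fun Λ₁ Λ₂ => ⟨Λ₁ ∪ Λ₂, ?_, ?_⟩
    · exact sup_le_sup_left (Subfield.closure_mono (Set.inter_subset_inter_left _
        (by rw [Finset.coe_union]; exact Set.subset_union_left))) F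
    · exact sup_le_sup_left (Subfield.closure_mono (Set.inter_subset_inter_left _
        (by rw [Finset.coe_union]; exact Set.subset_union_right))) F
  have hle : F ⊔ L ≤ ⨆ Λ, T Λ := by
    refine sup_le ?_ fun y hy => ?_
    · exact le_trans (le_sup_left : F ≤ T ∅) (le_iSup T ∅)
    · refine (le_iSup T {y}) ((le_sup_right : _ ≤ T {y}) (Subfield.subset_closure ⟨?_, hy⟩))
      simp
  exact (Subfield.mem_iSup_of_directed hdir).mp (hle hx)

/-- Every element of a subfield `M` is a quotient of two elements of its valuation ring `V ∩ M`;
hence `M ⊆ Frac B` for any subring `B ⊇ V ∩ M`. [folklore] -/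
theorem subfield_le_closure_of_inf_subset (V : ValuationSubring Ω) (M : Subfield Ω) {B : Set Ω}
    (hB : ((V.toSubring ⊓ M.toSubring : Subring Ω) : Set Ω) ⊆ B) :
    M ≤ Subfield.closure B := by
  intro c hc
  rcases V.mem_or_inv_mem c with h | h
  · exact Subfield.subset_closure (hB ⟨h, hc⟩)
  · rw [← inv_inv c]
    exact inv_mem (Subfield.subset_closure (hB ⟨h, M.inv_mem hc⟩))

/-- **Knaf–Kuhlmann 2009, Prop. 3.4 (2), PROVED** (in the vendored form of
`FiniteExtensionUniformization.lean`: finite descent of smooth uniformizability from the constant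
extension `L` to a finitely generated `M|K`). Proof: apply the strong form of Prop. 3.2
(`knafKuhlmann2009_prop32_adjoin`) to the given `O_L`-model of `F.L` and take for `M` the field
generated over `K` by `S₀` and by finitely many constants `Λ ⊆ L` with `G ⊆ F.K(Λ)`; then
`S'[G]`, `S' = V ∩ M`, is an `O_M`-model of `F.M`. The hypothesis "`L|K` algebraic" is not
needed. [cite: KnafKuhlmann2009, Prop. 3.4 (2)] -/
theorem KnafKuhlmann2009_Prop34_2_holds : KnafKuhlmann2009_Prop34_2.{u} := by
  intro Ω _ V K F L hKF hKL _ Z _ hZg hSU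
  classical
  obtain ⟨Zg, hZgZ, hZg⟩ := hZg
  obtain ⟨A, hAV, hAE, hfp, hfrac, hsm, hZ⟩ := hSU
  haveI := hfp
  let S : Type u := ↥(V.toSubring ⊓ L.toSubring)
  have hSinj : Function.Injective (algebraMap S Ω) := Subtype.coe_injective
  have hrangeS : Set.range (algebraMap S Ω) = ((V.toSubring ⊓ L.toSubring : Subring Ω) : Set Ω) :=
    Subtype.range_coe
  obtain ⟨S₀, G, hS₀S, hGA, hdesc⟩ := knafKuhlmann2009_prop32_adjoin V S hSinj A hAV hsm Z hZ
  -- finitely many constants `Λ g ⊆ L` with `g ∈ F.K(Λ g)`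
  have hGFL : ∀ g ∈ G, g ∈ F ⊔ L := by
    intro g hg
    obtain ⟨a, ha, b, hb, -, rfl⟩ := hGA g hg
    exact div_mem (hAE ha) (hAE hb)
  choose Λ hΛ using fun g (hg : g ∈ G) => exists_finset_mem_sup_closure F L (hGFL g hg)
  let sM : Finset Ω := (S₀ ∪ G.attach.biUnion fun g => Λ g.1 g.2).filter fun x => x ∈ L
  let M : Subfield Ω := Subfield.closure ((K : Set Ω) ∪ (sM : Set Ω))
  have hsML : (sM : Set Ω) ⊆ L := fun x hx => (Finset.mem_filter.mp (Finset.mem_coe.mp hx)).2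
  have hKM : K ≤ M := fun c hc => Subfield.subset_closure (Or.inl hc)
  have hsMM : (sM : Set Ω) ⊆ M := fun x hx => Subfield.subset_closure (Or.inr hx)
  have hML : M ≤ L := Subfield.closure_le.mpr (Set.union_subset hKL hsML)
  have hS₀VL : (S₀ : Set Ω) ⊆ ((V.toSubring ⊓ L.toSubring : Subring Ω) : Set Ω) := hrangeS ▸ hS₀S
  have hS₀sM : S₀ ⊆ sM := fun x hx =>
    Finset.mem_filter.mpr ⟨Finset.mem_union_left _ hx, (hS₀VL (Finset.mem_coe.mpr hx)).2⟩
  have hGFM : ∀ g ∈ G, g ∈ F ⊔ M := by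
    intro g hg
    refine (sup_le_sup_left (Subfield.closure_le.mpr ?_) F : F ⊔ _ ≤ F ⊔ M) (hΛ g hg)
    rintro x ⟨hx₁, hx₂⟩
    refine hsMM (Finset.mem_coe.mpr (Finset.mem_filter.mpr ⟨Finset.mem_union_right _ ?_, hx₂⟩))
    exact Finset.mem_biUnion.mpr ⟨⟨g, hg⟩, Finset.mem_attach _ _, Finset.mem_coe.mp hx₁⟩
  -- the base `S' := V ∩ M`
  let S' : Type u := ↥(V.toSubring ⊓ M.toSubring)
  have hS'inj : Function.Injective (algebraMap S' Ω) := Subtype.coe_injective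
  have hrangeS' : Set.range (algebraMap S' Ω) =
      ((V.toSubring ⊓ M.toSubring : Subring Ω) : Set Ω) := Subtype.range_coe
  have hS₀S' : (S₀ : Set Ω) ⊆ Set.range (algebraMap S' Ω) := by
    rw [hrangeS']
    intro x hx
    exact ⟨(hS₀VL hx).1, hsMM (Finset.mem_coe.mpr (hS₀sM (Finset.mem_coe.mp hx)))⟩
  have hS'S : Set.range (algebraMap S' Ω) ⊆ Set.range (algebraMap S Ω) := by
    rw [hrangeS', hrangeS]
    rintro x ⟨hxV, hxM⟩
    exact ⟨hxV, hML hxM⟩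
  obtain ⟨A', hA'V, hA'eq, -, hfp', hsm', hZ', -⟩ := hdesc S' hS'inj hS₀S' hS'S
  -- `A' ⊆ F.M` and `Frac A' = F.M`
  let FM : Subalgebra S' Ω :=
    { (F ⊔ M).toSubring with
      algebraMap_mem' := fun c => (le_sup_right : M ≤ F ⊔ M) c.2.2 }
  have hA'FM : (A' : Set Ω) ⊆ (F ⊔ M : Subfield Ω) := by
    rw [hA'eq]
    change Algebra.adjoin S' (G : Set Ω) ≤ FM
    exact Algebra.adjoin_le fun g hg => hGFM g hg
  have hFMA' : F ⊔ M ≤ Subfield.closure (A' : Set Ω) := by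
    refine sup_le ?_ (subfield_le_closure_of_inf_subset V M fun x hx => ?_)
    · rw [← hZg]
      refine Subfield.closure_le.mpr (Set.union_subset (fun c hc => ?_) fun z hz => ?_)
      · exact subfield_le_closure_of_inf_subset V M
          (fun x hx => A'.algebraMap_mem (⟨x, hx⟩ : S')) (hKM hc)
      · obtain ⟨a, ha, b, hb, -, rfl⟩ := hZ' z (hZgZ hz)
        exact div_mem (Subfield.subset_closure ha) (Subfield.subset_closure hb)
    · exact A'.algebraMap_mem (⟨x, hx⟩ : S')
  refine ⟨M, hKM, hML, ⟨sM, rfl⟩, A', hA'V, hA'FM, hfp', fun x hx => ?_, hsm', hZ'⟩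
  exact exists_div_of_mem_closure A'.toSubring (hFMA' hx)

/-! ## Knaf–Kuhlmann 2005, Cor. 2.2 -/

/-- **Knaf–Kuhlmann 2005, Cor. 2.2, PROVED** (in the vendored form of
`FiniteExtensionUniformization.lean`): for an Abhyankar place of a function field `F|K` the
value group `vF` is generated over `vK` by finitely many values and the residue field `FP` is
finitely generated over `KP`. Proof as printed: with `x, y` as in the definition of an Abhyankar
place and `F₀ := K(x, y)`, `F|F₀` is finite, `vF₀ = vK ⊕ ⊕ ℤv(xᵢ)` and `F₀P = KP(yP)`
(Knaf–Kuhlmann 2005, Thm. 2.1: `ValuationIndependence.lean`), and by the fundamental inequality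
a finite extension enlarges value group and residue field only finitely (families with values
in distinct cosets, resp. with linearly independent residues, are linearly independent).
[cite: KnafKuhlmann2005, Cor. 2.2] -/
theorem KnafKuhlmann2005_Cor22_holds : KnafKuhlmann2005_Cor22.{u} := by
  intro Ω _ V K F hKF hfg hAbh
  classical
  obtain ⟨ρ, τ, x, y, hy, hxF, hyF, hxi, hri, halg⟩ := hAbh
  have hx0 : ∀ i, x i ≠ 0 := fun i => (hxF i).2
  -- `F₀ := K(x, y)` and `F` as a finite-dimensional intermediate field `T` over `F₀`
  let S : Set Ω := Set.range x ∪ Set.range y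
  let F₀ : Subfield Ω := Subfield.closure ((K : Set Ω) ∪ S)
  have hKF₀ : K ≤ F₀ := fun c hc => Subfield.subset_closure (Or.inl hc)
  have hSF : S ⊆ F := by
    rintro z (⟨i, rfl⟩ | ⟨j, rfl⟩)
    · exact (hxF i).1
    · exact hyF j
  have hF₀F : F₀ ≤ F := Subfield.closure_le.mpr (Set.union_subset hKF hSF)
  obtain ⟨s, hs⟩ := hfg
  let T : IntermediateField F₀ Ω := IntermediateField.adjoin F₀ (s : Set Ω)
  have hTF : ∀ z, z ∈ T ↔ z ∈ F := by
    intro z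
    rw [mem_adjoin_subfield_iff F₀ (s : Set Ω) z]
    have : Subfield.closure ((F₀ : Set Ω) ∪ (s : Set Ω)) = F := by
      apply le_antisymm
      · refine Subfield.closure_le.mpr (Set.union_subset hF₀F fun z hz => ?_)
        rw [← hs]
        exact Subfield.subset_closure (Or.inr hz)
      · rw [← hs]
        exact Subfield.closure_mono (Set.union_subset_union_left _ fun c hc => hKF₀ hc)
    rw [this]
  have halgF₀ : ∀ z ∈ F, IsAlgebraic F₀ z := fun z hz =>
    (isAlgebraic_closure_iff K S z).mpr (halg z hz)
  haveI : FiniteDimensional F₀ T :=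
    IntermediateField.finiteDimensional_adjoin fun z hz =>
      (halgF₀ z (hs ▸ Subfield.subset_closure (Or.inr hz))).isIntegral
  set n : ℕ := Module.finrank F₀ T with hn
  -- the subgroup `H = vF₀ = vK · ∏ v(xᵢ)^ℤ`
  let inH : V.ValueGroup → Prop := fun γ =>
    ∃ b ∈ K, ∃ m : Fin ρ → ℤ, γ = V.valuation b * ∏ i, V.valuation (x i) ^ (m i)
  have hvx0 : ∀ i, V.valuation (x i) ≠ 0 := fun i => (map_ne_zero V.valuation).mpr (hx0 i)
  have hH_F₀ : ∀ a ∈ F₀, a ≠ 0 → inH (V.valuation a) := fun a ha ha0 => by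
    obtain ⟨m, b, hb, h⟩ := exists_valuation_eq_of_mem_closure V K hx0 hxi hy hri ha ha0
    exact ⟨b, hb, m, h⟩
  have hH_one : inH 1 := ⟨1, one_mem K, 0, by simp⟩
  have hH_mul : ∀ γ γ', inH γ → inH γ' → inH (γ * γ') := by
    rintro γ γ' ⟨b, hb, m, rfl⟩ ⟨b', hb', m', rfl⟩
    refine ⟨b * b', mul_mem hb hb', m + m', ?_⟩
    have : (∏ i, V.valuation (x i) ^ ((m + m') i)) =
        (∏ i, V.valuation (x i) ^ (m i)) * ∏ i, V.valuation (x i) ^ (m' i) := by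
      rw [← Finset.prod_mul_distrib]
      exact Finset.prod_congr rfl fun i _ => by rw [Pi.add_apply, zpow_add₀ (hvx0 i)]
    rw [map_mul, this]
    ac_rfl
  have hH_inv : ∀ γ, γ ≠ 0 → inH γ → inH γ⁻¹ := by
    rintro γ hγ ⟨b, hb, m, rfl⟩
    refine ⟨b⁻¹, inv_mem hb, -m, ?_⟩
    rw [map_inv₀, mul_inv, ← Finset.prod_inv_distrib]
    congr 1
    exact Finset.prod_congr rfl fun i _ => by rw [Pi.neg_apply, zpow_neg]
  ------------------------------------------------------------------
  -- Part 1: the value group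
  ------------------------------------------------------------------
  let P : ℕ → Prop := fun m => ∃ t : Finset Ω, t.card = m ∧ (∀ a ∈ t, a ∈ F ∧ a ≠ 0) ∧
    ∀ a ∈ t, ∀ a' ∈ t, a ≠ a' → ¬ inH (V.valuation a / V.valuation a')
  have hPbound : ∀ m, P m → m ≤ n := by
    rintro m ⟨t, rfl, ht, hdis⟩
    have := card_le_finrank_of_valuation_ne V T (fun a : t => (a : Ω))
      (fun a => (hTF a).mpr (ht a a.2).1) (fun a => (ht a a.2).2) ?_
    · simpa using this
    · intro i j hij c hc c' hc' hc0 hc'0 heq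
      have hij' : (i : Ω) ≠ j := fun h => hij (Subtype.ext h)
      apply hdis i i.2 j j.2 hij'
      -- `v(aᵢ)/v(aⱼ) = v(c'/c) ∈ H`
      have hai : V.valuation (i : Ω) ≠ 0 := (map_ne_zero V.valuation).mpr (ht i i.2).2
      have haj : V.valuation (j : Ω) ≠ 0 := (map_ne_zero V.valuation).mpr (ht j j.2).2
      have hvc : V.valuation c ≠ 0 := (map_ne_zero V.valuation).mpr hc0
      have key : V.valuation (i : Ω) / V.valuation (j : Ω) = V.valuation (c' / c) := by
        rw [map_mul, map_mul] at heq
        rw [map_div₀]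
        field_simp
        rw [mul_comm, heq, mul_comm]
      rw [key]
      exact hH_F₀ _ (div_mem hc' hc) (div_ne_zero hc'0 hc0)
  have hP0 : P 0 := ⟨∅, rfl, by simp, by simp⟩
  let m₀ := Nat.findGreatest P n
  obtain ⟨t, htcard, ht, hdis⟩ : P m₀ := Nat.findGreatest_spec (Nat.zero_le n) hP0
  -- every non-zero `a ∈ F` is `H`-equivalent to an element of `t`
  have hcover : ∀ a ∈ F, a ≠ 0 → ∃ a' ∈ t, inH (V.valuation a / V.valuation a') := by
    intro a haF ha0
    by_contra hnot
    have hat : a ∉ t := fun hat => hnot ⟨a, hat, by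
      rw [div_self ((map_ne_zero V.valuation).mpr ha0)]; exact hH_one⟩
    have hP1 : P (m₀ + 1) := by
      refine ⟨insert a t, by rw [Finset.card_insert_of_notMem hat, htcard], ?_, ?_⟩
      · intro b hb
        rcases Finset.mem_insert.mp hb with rfl | hb
        · exact ⟨haF, ha0⟩
        · exact ht b hb
      · intro b hb b' hb' hbb'
        rcases Finset.mem_insert.mp hb with hb1 | hb1 <;>
          rcases Finset.mem_insert.mp hb' with hb2 | hb2
        · exact absurd (hb1.trans hb2.symm) hbb'
        · subst hb1
          exact fun h => hnot ⟨b', hb2, h⟩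
        · subst hb2
          intro h
          apply hnot
          refine ⟨b, hb1, ?_⟩
          have h' := hH_inv _ (div_ne_zero ((map_ne_zero V.valuation).mpr (ht b hb1).2)
            ((map_ne_zero V.valuation).mpr ha0)) h
          rwa [inv_div] at h'
        · exact hdis b hb1 b' hb2 hbb'
    have h1 : m₀ + 1 ≤ n := hPbound _ hP1
    exact Nat.findGreatest_is_greatest (Nat.lt_succ_self m₀) h1 hP1
  ------------------------------------------------------------------
  -- Part 2: the residue field
  ------------------------------------------------------------------
  let RF := ResidueField V
  let B₀ : Subfield RF := resField V F₀
  let Q : ℕ → Prop := fun k => ∃ u : Finset RF, u.card = k ∧ (u : Set RF) ⊆ resField V F ∧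
    LinearIndepOn B₀ id (u : Set RF)
  have hQbound : ∀ k, Q k → k ≤ n := by
    rintro k ⟨u, rfl, huF, hli⟩
    -- preimages of the residues in `V ∩ F`
    have hpre : ∀ r : u, ∃ a : V, (a : Ω) ∈ F ∧ residue V a = r := fun r =>
      (mem_resField_iff V F r).mp (huF r.2)
    choose a haF hares using hpre
    have := card_le_finrank_of_residue_linearIndependent V T (fun r : u => ((a r : V) : Ω))
      (fun r => (hTF _).mpr (haF r)) (fun r => (a r).2) ?_
    · simpa using this
    · have heq : (fun r : u => residue V ⟨((a r : V) : Ω), (a r).2⟩) = fun r : u => (r : RF) := by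
        funext r
        rw [← hares r]
      rw [heq]
      exact hli
  have hQ0 : Q 0 := ⟨∅, rfl, by simp, by simp [LinearIndepOn]⟩
  let k₀ := Nat.findGreatest Q n
  obtain ⟨u, hucard, huF, hli⟩ : Q k₀ := Nat.findGreatest_spec (Nat.zero_le n) hQ0
  have hspan : ∀ r ∈ resField V F, r ∈ Submodule.span B₀ (u : Set RF) := by
    intro r hr
    by_contra hnot
    have hru : r ∉ u := fun hru => hnot (Submodule.subset_span hru)
    have hQ1 : Q (k₀ + 1) := by
      refine ⟨insert r u, by rw [Finset.card_insert_of_notMem hru, hucard], ?_, ?_⟩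
      · rw [Finset.coe_insert]
        exact Set.insert_subset hr huF
      · rw [Finset.coe_insert]
        exact hli.id_insert hnot
    exact Nat.findGreatest_is_greatest (Nat.lt_succ_self k₀) (hQbound _ hQ1) hQ1
  -- conclusion
  refine ⟨?_, ?_⟩
  · -- value group: `x' := x ++ t`
    let k := t.card
    let e : ↥t ≃ Fin k := t.equivFin
    let x₂ : Fin k → Ω := fun j => ((e.symm j : t) : Ω)
    refine ⟨ρ + k, Fin.append x x₂, fun i => ?_, fun a haF ha0 => ?_⟩
    · refine Fin.addCases (fun i => ?_) (fun j => ?_) i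
      · rw [Fin.append_left]; exact hxF i
      · rw [Fin.append_right]; exact ht _ (e.symm j).2
    · obtain ⟨a', ha't, b, hb, m, hm⟩ := hcover a haF ha0
      let j₀ : Fin k := e ⟨a', ha't⟩
      let m₂ : Fin k → ℤ := fun j => if j = j₀ then 1 else 0
      refine ⟨Fin.append m m₂, b, hb, ?_⟩
      have ha'0 : V.valuation a' ≠ 0 := (map_ne_zero V.valuation).mpr (ht a' ha't).2
      rw [div_eq_iff ha'0] at hm
      rw [hm, Fin.prod_univ_add]
      have h3 : (∏ i : Fin ρ, V.valuation (Fin.append x x₂ (Fin.castAdd k i)) ^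
          (Fin.append m m₂ (Fin.castAdd k i))) = ∏ i, V.valuation (x i) ^ (m i) :=
        Finset.prod_congr rfl fun i _ => by rw [Fin.append_left, Fin.append_left]
      have h4 : (∏ j : Fin k, V.valuation (Fin.append x x₂ (Fin.natAdd ρ j)) ^
          (Fin.append m m₂ (Fin.natAdd ρ j))) = ∏ j : Fin k, V.valuation (x₂ j) ^ (m₂ j) :=
        Finset.prod_congr rfl fun j _ => by rw [Fin.append_right, Fin.append_right]
      have h2 : (∏ j : Fin k, V.valuation (x₂ j) ^ (m₂ j)) = V.valuation a' := by
        have : ∀ j : Fin k, V.valuation (x₂ j) ^ (m₂ j) =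
            if j = j₀ then V.valuation a' else 1 := by
          intro j
          by_cases hj : j = j₀
          · subst hj
            simp [m₂, x₂, j₀]
          · simp [m₂, hj]
        rw [Finset.prod_congr rfl fun j _ => this j, Finset.prod_ite_eq']
        simp
      rw [h3, h4, h2]
      ac_rfl
  · -- residue field: generators `yP ∪ u`
    let yP : Fin τ → RF := fun j => residue V ⟨y j, hy j⟩
    refine ⟨Finset.univ.image yP ∪ u, le_antisymm ?_ ?_⟩
    · refine Subfield.closure_le.mpr (Set.union_subset (resField_mono V hKF) ?_)
      rw [Finset.coe_union, Finset.coe_image]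
      refine Set.union_subset ?_ huF
      rintro _ ⟨j, -, rfl⟩
      exact residue_mem_resField V _ (hyF j)
    · intro r hr
      set C := Subfield.closure ((resField V K : Set RF) ∪ ((Finset.univ.image yP ∪ u : Finset RF) : Set RF))
      have hB₀C : (B₀ : Set RF) ⊆ C := by
        intro c hc
        obtain ⟨a, haF₀, rfl⟩ := (mem_resField_iff V F₀ c).mp hc
        have := residue_mem_closure_of_mem_closure V K hx0 hxi hy hri haF₀ a.2
        refine (Subfield.closure_mono ?_) this
        refine Set.union_subset_union_right _ ?_
        rintro _ ⟨j, rfl⟩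
        rw [Finset.coe_union, Finset.coe_image]
        exact Or.inl ⟨j, Finset.mem_coe.mpr (Finset.mem_univ j), rfl⟩
      have huC : (u : Set RF) ⊆ C := fun r hr =>
        Subfield.subset_closure (Or.inr (by rw [Finset.coe_union]; exact Or.inr hr))
      refine Submodule.span_induction (p := fun r _ => r ∈ C) (fun r hr => huC hr) (zero_mem C)
        (fun _ _ _ _ h₁ h₂ => add_mem h₁ h₂) (fun c r _ hr => ?_) (hspan r hr)
      rw [Subfield.smul_def, smul_eq_mul]
      exact mul_mem (hB₀C c.2) hr

end Literature.AlgebraicGeometry.Resolution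

end
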